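import Literature.Geometry.Lorentzian.CausalityPushUp

/-!
# Route SwallowTheDatum · item `SubdataDevelopmentsEmbed` (stmt-FinalStateConjecture-10053) —
# towards the domain of dependence of the sub-datum (`hcauchy`), V(a): the TRANSLATED TILT

The local step of the endpoint lemma of `…DoDEndpoint.lean` (a future timelike curve lies in
the chronological future of its past endpoint). The curves of the tree are merely
differentiable and a curve with past endpoint `e` is not defined at `e`, so neither
concatenation nor the push-up lemma applies directly. Instead (a variant of the tilt of
`Literature/…/CausalityPushUp.lean`, `exists_nhds_tilt`): in the chart `φ` at `e`, with `T₀` the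
coordinate orienting vector at `e`, `ℓ = -Ĝ(T₀, ·)` and the cone constant `c`
(`PushUp.exists_cone_const`), the TRANSLATED AND TILTED curve
`C(σ) = ẑ(σ) - ẑ(a) + ê + κ ℓ(ẑ σ - ẑ a) T₀` on `[a, b]` starts AT `ê`; the tilt gains a
timelike margin `-κ ℓ(v)²` (`PushUp.tilt_neg`) which absorbs both the displacement of the base
point by the tilt, `O(κ)`, and by the translation `‖ẑ a - ê‖ ≤ θκ` (Lipschitz continuity of the
`C¹` coordinate metric). O'Neill 1983, Ch. 14, proof of Lemma 3 / Prop. 10.46 technique.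

No definition, no named fact.
-/

noncomputable section

open Function Set Filter Topology TopologicalSpace Bundle Manifold
open scoped Manifold ContDiff Topology

namespace Summit.FinalStateConjecture.FinalStateConjecture.Theorems

namespace SubdataDevelopmentsEmbed

open Literature.Geometry.Lorentzian

section Endpoint

variable {E : Type*} [NormedAddCommGroup E] [NormedSpace ℝ E] {H : Type*} [TopologicalSpace H]
  {I : ModelWithCorners ℝ E H} {n : ℕ∞ω} {M : Type*} [TopologicalSpace M] [ChartedSpace H M]
  [IsManifold I ∞ M] {g : LorentzianMetric I n M} {τ : TimeOrientation g}

/-- **The local step of the endpoint lemma.** For every point `e` there is a neighbourhood `N`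
such that: for every future timelike curve `γ` on `[a, b]`, `a < b`, with values in `N`, if
`φ(γ a)` is close enough to `φ e` — precisely `‖φ(γ a) - φ e‖ ≤ θ κ` for the scale `θ` of `N` and
a parameter `0 < κ ≤ 1` — then there is a future timelike curve on `[a, b]` from `e` ITSELF to
the point `φ⁻¹(φ(γ b) - φ(γ a) + φ e + κ ℓ(φ(γ b) - φ(γ a)) T₀)` (the translated tilted curve of
the module docstring). Quantitatively: `N`, `θ`, `T₀`, `ℓ` and a bound `A` are produced first,
and the endpoint is within `κ A` of `φ(γ b)` in the chart. -/
theorem exists_nhds_translate_tilt [BoundarylessManifold I M] [FiniteDimensional ℝ E] (hn : 1 ≤ n)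
    (e : M) :
    ∃ N ∈ 𝓝 e, ∃ θ > (0 : ℝ), ∃ A : ℝ, ∃ (T₀ : E) (ℓL : E →L[ℝ] ℝ),
      N ⊆ (extChartAt I e).source ∧
      ∀ (γ : ℝ → M) (a b : ℝ), a < b → g.IsFutureTimelikeCurveOn τ γ (Icc a b) →
        (∀ s ∈ Icc a b, γ s ∈ N) → ∀ κ : ℝ, 0 < κ → κ ≤ 1 →
        ‖extChartAt I e (γ a) - extChartAt I e e‖ ≤ θ * κ →
        ∃ β : ℝ → M, g.IsFutureTimelikeCurveOn τ β (Icc a b) ∧ β a = e ∧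
          β b = (extChartAt I e).symm (extChartAt I e (γ b) - extChartAt I e (γ a) +
            extChartAt I e e + (κ * ℓL (extChartAt I e (γ b) - extChartAt I e (γ a))) • T₀) ∧
          ‖(extChartAt I e (γ b) - extChartAt I e (γ a) + extChartAt I e e +
            (κ * ℓL (extChartAt I e (γ b) - extChartAt I e (γ a))) • T₀) - extChartAt I e (γ b)‖
            ≤ κ * A ∧
          (extChartAt I e (γ b) - extChartAt I e (γ a) + extChartAt I e e +
            (κ * ℓL (extChartAt I e (γ b) - extChartAt I e (γ a))) • T₀) ∈
            (extChartAt I e).target := by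
  set p := e with hpdef
  -- the chart at `p`
  set x₀ : E := extChartAt I p p with hx₀def
  have hx₀t : x₀ ∈ (extChartAt I p).target :=
    (extChartAt I p).map_source (mem_extChartAt_source p)
  have hx₀p : (extChartAt I p).symm x₀ = p := (extChartAt I p).left_inv (mem_extChartAt_source p)
  have htarget : (extChartAt I p).target ∈ 𝓝 x₀ := by
    have hint : x₀ ∈ interior (extChartAt I p).target :=
      ModelWithCorners.isInteriorPoint_iff.mp (BoundarylessManifold.isInteriorPoint (I := I))
    exact mem_interior_iff_mem_nhds.mp hint
  -- the metric and the time orientation in coordinates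
  set T₀ : E := τ.coordTime p x₀ with hT₀def
  set ℓL : E →L[ℝ] ℝ := -(g.coordMetric p x₀ T₀) with hℓLdef
  have hℓL : ∀ w, ℓL w = -(g.coordMetric p x₀ T₀ w) := fun w ↦ rfl
  have hGcd : ContDiffOn ℝ 1 (g.coordMetric p) (extChartAt I p).target :=
    g.contDiffOn_coordMetric hn p
  have hGc : ContinuousAt (g.coordMetric p) x₀ := (hGcd.continuousOn x₀ hx₀t).continuousAt htarget
  have hGTc : ContinuousAt (fun x ↦ g.coordMetric p x (τ.coordTime p x)) x₀ :=
    ((hGcd.continuousOn.clm_apply (τ.continuousOn_coordTime hn p)) x₀ hx₀t).continuousAt htarget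
  have hyb : (extChartAt I p).symm x₀ ∈ (trivializationAt E (TangentSpace I) p).baseSet := by
    rw [hx₀p]; simp
  have hsymmT₀ : (trivializationAt E (TangentSpace I) p).symmL ℝ ((extChartAt I p).symm x₀) T₀ =
      τ.vectorField ((extChartAt I p).symm x₀) := by
    rw [hT₀def, τ.coordTime_apply hx₀t, Trivialization.symmL_continuousLinearMapAt _ hyb]
  have hT₀T₀ : g.coordMetric p x₀ T₀ T₀ < 0 := by
    rw [g.coordMetric_apply hx₀t T₀ T₀, hsymmT₀]
    exact τ.isTimelike _
  have hT₀0 : T₀ ≠ 0 := by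
    intro h0
    have : g.coordMetric p x₀ T₀ T₀ = 0 := by rw [h0]; simp
    linarith
  have hpos : ∀ v : E, v ≠ 0 → g.coordMetric p x₀ v v ≤ 0 → g.coordMetric p x₀ T₀ v ≤ 0 →
      g.coordMetric p x₀ T₀ v < 0 := by
    intro v hv0 hvv hTv
    refine lt_of_le_of_ne hTv fun h0 ↦ ?_
    have hc : g.IsCausal
        ((trivializationAt E (TangentSpace I) p).symmL ℝ ((extChartAt I p).symm x₀) v) :=
      (isCausal_symmL_iff hx₀t v).mpr ⟨hvv, hv0⟩
    refine g.val_ne_zero_of_isTimelike_of_isCausal (τ.isTimelike ((extChartAt I p).symm x₀)) hc ?_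
    rw [← hsymmT₀, ← g.coordMetric_apply hx₀t]
    exact h0
  obtain ⟨c, hc, m, hm, hcone⟩ := PushUp.exists_cone_const (g.coordMetric p x₀) T₀ hpos
  obtain ⟨δ₁, hδ₁, hδ₁'⟩ : ∃ δ > 0, ∀ z : E, ‖z - x₀‖ < δ → z ∈ (extChartAt I p).target ∧
      g.coordMetric p z T₀ T₀ < 0 ∧ g.coordMetric p z (τ.coordTime p z) T₀ < 0 := by
    have h1 : ∀ᶠ z in 𝓝 x₀, z ∈ (extChartAt I p).target := htarget
    have h4 : ∀ᶠ z in 𝓝 x₀, g.coordMetric p z T₀ T₀ < 0 := by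
      have hcts : ContinuousAt (fun z ↦ g.coordMetric p z T₀ T₀) x₀ :=
        (hGc.clm_apply continuousAt_const).clm_apply continuousAt_const
      exact hcts.preimage_mem_nhds (Iio_mem_nhds hT₀T₀)
    have h5 : ∀ᶠ z in 𝓝 x₀, g.coordMetric p z (τ.coordTime p z) T₀ < 0 := by
      have hcts : ContinuousAt (fun z ↦ g.coordMetric p z (τ.coordTime p z) T₀) x₀ :=
        hGTc.clm_apply continuousAt_const
      exact hcts.preimage_mem_nhds (Iio_mem_nhds hT₀T₀)
    obtain ⟨δ, hδ, h⟩ := Metric.eventually_nhds_iff.mp (h1.and (h4.and h5))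
    exact ⟨δ, hδ, fun z hz ↦ h (by rwa [dist_eq_norm])⟩
  have hm₁ : 0 < min m (c / (2 * (‖T₀‖ + 1))) := lt_min hm (by positivity)
  obtain ⟨δ₂, hδ₂, hδ₂'⟩ : ∃ δ > 0, ∀ z : E, ‖z - x₀‖ < δ →
      ‖g.coordMetric p z - g.coordMetric p x₀‖ < min m (c / (2 * (‖T₀‖ + 1))) :=
    (NormedAddCommGroup.tendsto_nhds_nhds (f := g.coordMetric p) (x := x₀)
      (y := g.coordMetric p x₀)).1 hGc.tendsto _ hm₁
  obtain ⟨δ₃, hδ₃, hδ₃'⟩ : ∃ δ > 0, ∀ z : E, ‖z - x₀‖ < δ →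
      ‖g.coordMetric p z (τ.coordTime p z) - g.coordMetric p x₀ T₀‖ < m :=
    (NormedAddCommGroup.tendsto_nhds_nhds (f := fun x ↦ g.coordMetric p x (τ.coordTime p x))
      (x := x₀) (y := g.coordMetric p x₀ T₀)).1 hGTc.tendsto _ hm
  obtain ⟨K, t, ht, hK⟩ := (hGcd.contDiffAt htarget).exists_lipschitzOnWith
  obtain ⟨r₂, hr₂, hr₂t⟩ := Metric.mem_nhds_iff.mp ht
  -- the scales `r`, `θ`, `ρ`
  set r : ℝ := min (min δ₁ δ₂) (min δ₃ r₂) with hrdef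
  have hr0 : 0 < r := lt_min (lt_min hδ₁ hδ₂) (lt_min hδ₃ hr₂)
  have hrδ₁ : r ≤ δ₁ := (min_le_left _ _).trans (min_le_left _ _)
  have hrδ₂ : r ≤ δ₂ := (min_le_left _ _).trans (min_le_right _ _)
  have hrδ₃ : r ≤ δ₃ := (min_le_right _ _).trans (min_le_left _ _)
  have hrr₂ : r ≤ r₂ := (min_le_right _ _).trans (min_le_right _ _)
  have hK0 : (0 : ℝ) ≤ K := K.coe_nonneg
  have hA0 : 0 < (1 / c + ‖T₀‖) ^ 2 := by positivity
  -- `θ₂ = 2 θ` plays the role of PushUp's `θ`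
  set θ₂ : ℝ := min (r / 2) (1 / (2 * ((K : ℝ) + 1) * (1 / c + ‖T₀‖) ^ 2)) with hθ₂def
  have hθ₂0 : 0 < θ₂ := lt_min (by positivity) (by positivity)
  have hθ₂r : θ₂ ≤ r / 2 := min_le_left _ _
  have hKθ : (K : ℝ) * θ₂ * (1 / c + ‖T₀‖) ^ 2 ≤ 1 / 2 := by
    have h1 : θ₂ ≤ 1 / (2 * ((K : ℝ) + 1) * (1 / c + ‖T₀‖) ^ 2) := min_le_right _ _
    have h2 : (K : ℝ) / ((K : ℝ) + 1) ≤ 1 := by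
      rw [div_le_one (by positivity)]; linarith
    calc (K : ℝ) * θ₂ * (1 / c + ‖T₀‖) ^ 2
        ≤ (K : ℝ) * (1 / (2 * ((K : ℝ) + 1) * (1 / c + ‖T₀‖) ^ 2)) * (1 / c + ‖T₀‖) ^ 2 :=
          mul_le_mul_of_nonneg_right (mul_le_mul_of_nonneg_left h1 hK0) hA0.le
      _ = ((K : ℝ) / ((K : ℝ) + 1)) * (1 / 2) := by field_simp
      _ ≤ 1 * (1 / 2) := mul_le_mul_of_nonneg_right h2 (by norm_num)
      _ = 1 / 2 := one_mul _
  set θ : ℝ := θ₂ / 2 with hθdef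
  have hθ0 : 0 < θ := by positivity
  set ρ : ℝ := min (r / 2) (θ / (2 * (‖ℓL‖ + 1) * (‖T₀‖ + 1))) with hρdef
  have hρ0 : 0 < ρ := lt_min (by positivity) (by positivity)
  have hρr : ρ ≤ r / 2 := min_le_left _ _
  have hρθ : ‖ℓL‖ * (2 * ρ) * ‖T₀‖ ≤ θ := by
    have h1 : ρ ≤ θ / (2 * (‖ℓL‖ + 1) * (‖T₀‖ + 1)) := min_le_right _ _
    have h2 : ρ * (2 * (‖ℓL‖ + 1) * (‖T₀‖ + 1)) ≤ θ := (le_div_iff₀ (by positivity)).mp h1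
    have e1 : 0 ≤ ρ * ‖ℓL‖ := mul_nonneg hρ0.le (norm_nonneg _)
    have e2 : 0 ≤ ρ * ‖T₀‖ := mul_nonneg hρ0.le (norm_nonneg _)
    have e3 : 0 ≤ ρ * ‖ℓL‖ * ‖T₀‖ := mul_nonneg e1 (norm_nonneg _)
    nlinarith [e1, e2, e3, hρ0.le, norm_nonneg ℓL, norm_nonneg T₀]
  -- the neighbourhood `N` and the bound `A`
  set N : Set M := (extChartAt I p).source ∩ extChartAt I p ⁻¹' Metric.ball x₀ ρ with hNdef
  have hN : N ∈ 𝓝 p := Filter.inter_mem (extChartAt_source_mem_nhds p)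
    ((continuousAt_extChartAt p).preimage_mem_nhds
      (Metric.isOpen_ball.mem_nhds (Metric.mem_ball_self hρ0)))
  have hballr : Metric.ball x₀ r ⊆ (extChartAt I p).target := fun z hz ↦
    (hδ₁' z (lt_of_lt_of_le (by rw [← dist_eq_norm]; exact Metric.mem_ball.mp hz) hrδ₁)).1
  refine ⟨N, hN, θ, hθ0, θ + ‖ℓL‖ * (2 * ρ) * ‖T₀‖, T₀, ℓL, inter_subset_left,
    fun γ a b hab hγ hγN κ hκ0 hκ1 hclose ↦ ?_⟩
  have hNs : ∀ s ∈ Icc a b, γ s ∈ (chartAt H p).source := fun s hs ↦ by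
    rw [← extChartAt_source I p]; exact (hγN s hs).1
  have hNb : ∀ s ∈ Icc a b, ‖extChartAt I p (γ s) - x₀‖ < ρ := fun s hs ↦ by
    have := (hγN s hs).2
    rwa [mem_preimage, Metric.mem_ball, dist_eq_norm] at this
  have ha : a ∈ Icc a b := left_mem_Icc.mpr hab.le
  have hb : b ∈ Icc a b := right_mem_Icc.mpr hab.le
  -- the curve and its velocity in coordinates
  set z : ℝ → E := fun s ↦ extChartAt I p (γ s) with hzdef
  set u : ℝ → E := fun s ↦ (trivializationAt E (TangentSpace I) p).continuousLinearMapAt ℝ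
    (γ s) (velocity I γ s) with hudef
  have hcu : ∀ s ∈ Icc a b, HasDerivAt z (u s) s ∧
      (g.coordMetric p (z s) (u s) (u s) ≤ 0 ∧ u s ≠ 0) ∧
      g.coordMetric p (z s) (τ.coordTime p (z s)) (u s) < 0 := by
    intro s hs
    obtain ⟨hmd, -, hfd⟩ := hγ s hs
    exact ⟨hasDerivAt_extChartAt_comp_continuousLinearMapAt (p := p) hmd (hNs s hs),
      (isFutureDirected_iff_coord (hNs s hs) _).mp hfd⟩
  -- the translation vector `w = ê - ẑ a`, `‖w‖ ≤ θκ`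
  set w : E := x₀ - z a with hwdef
  have hw : ‖w‖ ≤ θ * κ := by
    rw [hwdef, ← norm_neg, neg_sub]
    exact hclose
  -- the translated tilted curve
  set C : ℝ → E := fun s ↦ z s + w + (κ * ℓL (z s - z a)) • T₀ with hCdef
  set C' : ℝ → E := fun s ↦ u s + (κ * ℓL (u s)) • T₀ with hC'def
  have hCd : ∀ s ∈ Icc a b, HasDerivAt C (C' s) s := by
    intro s hs
    have hd := (hcu s hs).1
    have h2 : HasDerivAt (fun s ↦ ℓL (z s - z a)) (ℓL (u s)) s := by
      have h3 : HasDerivAt (fun s ↦ z s - z a) (u s) s := hd.sub_const (z a)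
      exact ℓL.hasFDerivAt.comp_hasDerivAt s h3
    have h4 : HasDerivAt (fun s ↦ z s + w) (u s) s := hd.add_const w
    exact h4.add ((h2.const_mul κ).smul_const T₀)
  -- the estimates along the curve (verbatim PushUp, with displacement `≤ 2θκ = θ₂ κ`)
  have hkey : ∀ s ∈ Icc a b, HasDerivAt C (C' s) s ∧ C s ∈ Metric.ball x₀ r ∧
      g.coordMetric p (C s) (C' s) (C' s) < 0 ∧
      g.coordMetric p (C s) (τ.coordTime p (C s)) (C' s) < 0 := by
    intro s hs
    obtain ⟨-, ⟨hvv, hv0⟩, hvf⟩ := hcu s hs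
    have hzs : ‖z s - x₀‖ < ρ := hNb s hs
    have hza : ‖z a - x₀‖ < ρ := hNb a ha
    have hlev : ‖C s - z s‖ ≤ θ₂ * κ := by
      have h0 : C s - z s = w + (κ * ℓL (z s - z a)) • T₀ := by
        simp only [hCdef]; abel
      have hza' : ‖z s - z a‖ ≤ 2 * ρ := by
        calc ‖z s - z a‖ = ‖(z s - x₀) - (z a - x₀)‖ := by abel_nf
          _ ≤ ‖z s - x₀‖ + ‖z a - x₀‖ := norm_sub_le _ _
          _ ≤ 2 * ρ := by linarith
      have h1 : |ℓL (z s - z a)| ≤ ‖ℓL‖ * (2 * ρ) := by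
        calc |ℓL (z s - z a)| = ‖ℓL (z s - z a)‖ := (Real.norm_eq_abs _).symm
          _ ≤ ‖ℓL‖ * ‖z s - z a‖ := ℓL.le_opNorm _
          _ ≤ ‖ℓL‖ * (2 * ρ) := mul_le_mul_of_nonneg_left hza' (norm_nonneg _)
      have h2 : ‖(κ * ℓL (z s - z a)) • T₀‖ ≤ θ * κ := by
        rw [norm_smul, Real.norm_eq_abs, abs_mul, abs_of_pos hκ0]
        calc κ * |ℓL (z s - z a)| * ‖T₀‖ ≤ κ * (‖ℓL‖ * (2 * ρ)) * ‖T₀‖ :=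
              mul_le_mul_of_nonneg_right (mul_le_mul_of_nonneg_left h1 hκ0.le) (norm_nonneg _)
          _ = κ * (‖ℓL‖ * (2 * ρ) * ‖T₀‖) := by ring
          _ ≤ κ * θ := mul_le_mul_of_nonneg_left hρθ hκ0.le
          _ = θ * κ := mul_comm _ _
      rw [h0]
      calc ‖w + (κ * ℓL (z s - z a)) • T₀‖ ≤ ‖w‖ + ‖(κ * ℓL (z s - z a)) • T₀‖ := norm_add_le _ _
        _ ≤ θ * κ + θ * κ := add_le_add hw h2
        _ = θ₂ * κ := by rw [hθdef]; ring
    have hzsr : ‖z s - x₀‖ < r := by linarith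
    have hCsr : ‖C s - x₀‖ < r := by
      calc ‖C s - x₀‖ = ‖(C s - z s) + (z s - x₀)‖ := by abel_nf
        _ ≤ ‖C s - z s‖ + ‖z s - x₀‖ := norm_add_le _ _
        _ < θ₂ * κ + ρ := by linarith
        _ ≤ r / 2 * 1 + r / 2 := add_le_add (mul_le_mul hθ₂r hκ1 hκ0.le (by linarith)) hρr
        _ = r := by ring
    obtain ⟨hzt, hTTz, -⟩ := hδ₁' (z s) (lt_of_lt_of_le hzsr hrδ₁)
    obtain ⟨hCt, hTTC, hTcC⟩ := hδ₁' (C s) (lt_of_lt_of_le hCsr hrδ₁)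
    have hGz := hδ₂' (z s) (lt_of_lt_of_le hzsr hrδ₂)
    have hGC := hδ₂' (C s) (lt_of_lt_of_le hCsr hrδ₂)
    have hGTz := hδ₃' (z s) (lt_of_lt_of_le hzsr hrδ₃)
    set ℓ : ℝ := ℓL (u s) with hℓdef
    have hℓ : c * ‖u s‖ ≤ ℓ := by
      have := hcone (g.coordMetric p (z s)) (g.coordMetric p (z s) (τ.coordTime p (z s)))
        (lt_of_lt_of_le hGz (min_le_left _ _)) hGTz (u s) hvv hvf
      rw [hℓdef, hℓL]
      exact this
    have hℓ0 : 0 < ℓ := lt_of_lt_of_le (mul_pos hc (norm_pos_iff.mpr hv0)) hℓ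
    have hbound : ∀ w' : E,
        ‖g.coordMetric p w' - g.coordMetric p x₀‖ < min m (c / (2 * (‖T₀‖ + 1))) →
        g.coordMetric p w' T₀ (u s) ≤ -ℓ + c / 2 * ‖u s‖ := by
      intro w' hw'
      have h1 : g.coordMetric p w' T₀ (u s) - g.coordMetric p x₀ T₀ (u s) ≤
          ‖g.coordMetric p w' - g.coordMetric p x₀‖ * ‖T₀‖ * ‖u s‖ :=
        PushUp.bilin_sub_le (g.coordMetric p x₀) (g.coordMetric p w') T₀ (u s)
      have h2 : g.coordMetric p x₀ T₀ (u s) = -ℓ := by rw [hℓdef, hℓL, neg_neg]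
      have h4 : ‖g.coordMetric p w' - g.coordMetric p x₀‖ ≤ c / (2 * (‖T₀‖ + 1)) :=
        (le_of_lt hw').trans (min_le_right _ _)
      have h5 : ‖g.coordMetric p w' - g.coordMetric p x₀‖ * ‖T₀‖ ≤ c / 2 := by
        calc ‖g.coordMetric p w' - g.coordMetric p x₀‖ * ‖T₀‖
            ≤ c / (2 * (‖T₀‖ + 1)) * ‖T₀‖ := mul_le_mul_of_nonneg_right h4 (norm_nonneg _)
          _ ≤ c / (2 * (‖T₀‖ + 1)) * (‖T₀‖ + 1) :=
              mul_le_mul_of_nonneg_left (by linarith) (div_nonneg hc.le (by positivity))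
          _ = c / 2 := by field_simp
      have h6 : ‖g.coordMetric p w' - g.coordMetric p x₀‖ * ‖T₀‖ * ‖u s‖ ≤ c / 2 * ‖u s‖ :=
        mul_le_mul_of_nonneg_right h5 (norm_nonneg _)
      linarith
    have hvT : g.coordMetric p (z s) (u s) T₀ ≤ -ℓ + c / 2 * ‖u s‖ := by
      rw [g.coordMetric_comm hzt (u s) T₀]
      exact hbound (z s) hGz
    have hvT' : g.coordMetric p (C s) T₀ (u s) ≤ -ℓ + c / 2 * ‖u s‖ := hbound (C s) hGC
    have hGG : ‖g.coordMetric p (C s) - g.coordMetric p (z s)‖ ≤ κ * (K * θ₂) := by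
      have hCt₂ : C s ∈ t := hr₂t (Metric.mem_ball.mpr
        (by rw [dist_eq_norm]; exact lt_of_lt_of_le hCsr hrr₂))
      have hzt₂ : z s ∈ t := hr₂t (Metric.mem_ball.mpr
        (by rw [dist_eq_norm]; exact lt_of_lt_of_le hzsr hrr₂))
      have h1 : ‖g.coordMetric p (C s) - g.coordMetric p (z s)‖ ≤ K * ‖C s - z s‖ := by
        have h := hK.dist_le_mul (C s) hCt₂ (z s) hzt₂
        rw [dist_eq_norm (C s) (z s)] at h
        exact le_of_eq_of_le (dist_eq_norm (g.coordMetric p (C s)) (g.coordMetric p (z s))).symm h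
      calc ‖g.coordMetric p (C s) - g.coordMetric p (z s)‖ ≤ K * ‖C s - z s‖ := h1
        _ ≤ K * (θ₂ * κ) := mul_le_mul_of_nonneg_left hlev hK0
        _ = κ * (K * θ₂) := by ring
    have hsym : g.coordMetric p (z s) T₀ (u s) = g.coordMetric p (z s) (u s) T₀ :=
      g.coordMetric_comm hzt _ _
    have hneg := PushUp.tilt_neg hκ0 hκ1 hc hℓ hℓ0 hsym hvv hvT hTTz.le hGG (by positivity) hKθ
    have horient := PushUp.tilt_orient hκ0 hℓ hℓ0 hvT' hTTC.le
    have hC's : C' s = u s + (κ * ℓ) • T₀ := rfl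
    have hCC : g.coordMetric p (C s) (C' s) (C' s) < 0 := by
      rw [hC's]
      have : -(κ * ℓ ^ 2) / 2 < 0 := by
        have := mul_pos hκ0 (pow_pos hℓ0 2); linarith
      exact lt_of_le_of_lt hneg this
    have hfd : g.coordMetric p (C s) (τ.coordTime p (C s)) (C' s) < 0 := by
      have hT₀fd : τ.IsFutureDirected
          ((trivializationAt E (TangentSpace I) p).symmL ℝ ((extChartAt I p).symm (C s)) T₀) :=
        (isFutureDirected_symmL_iff hCt T₀).mpr ⟨⟨hTTC.le, hT₀0⟩, hTcC⟩
      have hT₀tl : g.IsTimelike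
          ((trivializationAt E (TangentSpace I) p).symmL ℝ ((extChartAt I p).symm (C s)) T₀) :=
        (isTimelike_symmL_iff hCt T₀).mpr hTTC
      have hV0 : C' s ≠ 0 := by
        intro h0
        have : g.coordMetric p (C s) (C' s) (C' s) = 0 := by rw [h0]; simp
        linarith
      have hVc : g.IsCausal
          ((trivializationAt E (TangentSpace I) p).symmL ℝ ((extChartAt I p).symm (C s)) (C' s)) :=
        (isCausal_symmL_iff hCt _).mpr ⟨hCC.le, hV0⟩
      have hval : g.val _
          ((trivializationAt E (TangentSpace I) p).symmL ℝ ((extChartAt I p).symm (C s)) T₀)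
          ((trivializationAt E (TangentSpace I) p).symmL ℝ ((extChartAt I p).symm (C s)) (C' s))
            < 0 :=
        lt_of_eq_of_lt (g.coordMetric_apply hCt T₀ (C' s)).symm horient
      have hVfd := (TimeOrientation.isFutureDirected_iff_val_neg τ hT₀fd hT₀tl hVc).mpr hval
      exact ((isFutureDirected_symmL_iff hCt (C' s)).mp hVfd).2
    exact ⟨hCd s hs, Metric.mem_ball.mpr (by rwa [dist_eq_norm]), hCC, hfd⟩
  have hβ : g.IsFutureTimelikeCurveOn τ ((extChartAt I p).symm ∘ C) (Icc a b) :=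
    isFutureTimelikeCurveOn_extChartAt_symm_comp (U := Metric.ball x₀ r) Metric.isOpen_ball
      hballr fun s hs ↦ hkey s hs
  have hCa : C a = x₀ := by
    simp only [hCdef, hwdef, sub_self, map_zero, mul_zero, zero_smul, add_zero]
    abel
  have hCb : C b = z b - z a + x₀ + (κ * ℓL (z b - z a)) • T₀ := by
    simp only [hCdef, hwdef]; abel
  refine ⟨(extChartAt I p).symm ∘ C, hβ, ?_, ?_, ?_, ?_⟩
  · show (extChartAt I p).symm (C a) = p
    rw [hCa]; exact hx₀p
  · show (extChartAt I p).symm (C b) = _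
    rw [hCb]
  · -- the endpoint is within `κ A` of `ẑ b`
    have h1 : z b - z a + x₀ + (κ * ℓL (z b - z a)) • T₀ - z b =
        w + (κ * ℓL (z b - z a)) • T₀ := by rw [hwdef]; abel
    rw [h1]
    have hza' : ‖z b - z a‖ ≤ 2 * ρ := by
      calc ‖z b - z a‖ = ‖(z b - x₀) - (z a - x₀)‖ := by abel_nf
        _ ≤ ‖z b - x₀‖ + ‖z a - x₀‖ := norm_sub_le _ _
        _ ≤ 2 * ρ := by linarith [hNb b hb, hNb a ha]
    have h2 : ‖(κ * ℓL (z b - z a)) • T₀‖ ≤ κ * (‖ℓL‖ * (2 * ρ) * ‖T₀‖) := by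
      rw [norm_smul, Real.norm_eq_abs, abs_mul, abs_of_pos hκ0]
      have h3 : |ℓL (z b - z a)| ≤ ‖ℓL‖ * (2 * ρ) := by
        calc |ℓL (z b - z a)| = ‖ℓL (z b - z a)‖ := (Real.norm_eq_abs _).symm
          _ ≤ ‖ℓL‖ * ‖z b - z a‖ := ℓL.le_opNorm _
          _ ≤ ‖ℓL‖ * (2 * ρ) := mul_le_mul_of_nonneg_left hza' (norm_nonneg _)
      calc κ * |ℓL (z b - z a)| * ‖T₀‖ ≤ κ * (‖ℓL‖ * (2 * ρ)) * ‖T₀‖ :=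
            mul_le_mul_of_nonneg_right (mul_le_mul_of_nonneg_left h3 hκ0.le) (norm_nonneg _)
        _ = κ * (‖ℓL‖ * (2 * ρ) * ‖T₀‖) := by ring
    calc ‖w + (κ * ℓL (z b - z a)) • T₀‖ ≤ ‖w‖ + ‖(κ * ℓL (z b - z a)) • T₀‖ := norm_add_le _ _
      _ ≤ θ * κ + κ * (‖ℓL‖ * (2 * ρ) * ‖T₀‖) := add_le_add hw h2
      _ = κ * (θ + ‖ℓL‖ * (2 * ρ) * ‖T₀‖) := by ring
  · rw [← hCb]
    exact hballr (hkey b hb).2.1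

end Endpoint

end SubdataDevelopmentsEmbed

end Summit.FinalStateConjecture.FinalStateConjecture.Theorems

end
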